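import Literature.Analysis.FunctionSpaces.LatticeFirstOrderAdjoint
import HarnessLib

/-!
# The adjoint of a composition `P Q` and of a Laplace-like operator `P₁Q₁ + P₂Q₂` (Warner 6.24, 6.31)

For first-order lattice operators the adjoint of the second-order composition `P ∘ Q`
(`Lattice.POp1.comp`) is `Q† ∘ P†`, and of the Laplace-like sum `P₁Q₁ + P₂Q₂` it is
`Q₁†P₁† + Q₂†P₂†`. We record both adjunctions `⟨L u, v⟩ = ⟨u, L† v⟩` and `⟨L† u, v⟩ = ⟨u, L v⟩`
(tempered against rapidly decreasing, from `POp1.pairing_apply_left`) and the symbols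
`σ_{L†}(k) = σ_L(k)†` (`compAdj_symbol`, `laplaceLikeAdj_symbol`). F. W. Warner, GTM 94 (1983),
6.24 (3)–(5), 6.31 (2).

## References

* F. W. Warner, GTM 94 (1983), 6.24, 6.31 (2). [WarnerGTM94]
-/

noncomputable section

open Filter Finset
open scoped ENNReal NNReal Topology InnerProductSpace ComplexConjugate

namespace Literature.Analysis.FunctionSpaces

namespace Lattice

open Torus

variable {d : Type*} [Fintype d]
variable {V W X : Type*} [NormedAddCommGroup V] [InnerProductSpace ℂ V] [NormedAddCommGroup W]
  [InnerProductSpace ℂ W] [NormedAddCommGroup X] [InnerProductSpace ℂ X]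
  [CompleteSpace V] [CompleteSpace W] [CompleteSpace X]

/-! ### Compositions -/

section Comp

variable (P : POp1 d W V) (Q : POp1 d V W)

/-- **The adjoint of `P ∘ Q` is `Q† ∘ P†`.** [cite: WarnerGTM94, 6.24 (3)] -/
def compAdj : POp d V V := Q.adj.comp P.adj

/-- `⟨(PQ) u, v⟩ = ⟨u, (Q†P†) v⟩`. [cite: WarnerGTM94, 6.31 (2)] -/
theorem pairing_comp_apply_left {u : (d → ℤ) → V} (hu : Tempered u) {v : (d → ℤ) → V} (hv : RapidDecay v) :
    pairing ((P.comp Q).apply u) v = pairing u ((compAdj P Q).apply v) := by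
  rw [POp1.apply_comp P Q hu, compAdj, POp1.apply_comp _ _ hv.tempered,
    P.pairing_apply_left (Q.tempered_apply hu) hv, Q.pairing_apply_left hu (P.adj.rapidDecay_apply hv)]

/-- `⟨(Q†P†) u, v⟩ = ⟨u, (PQ) v⟩`. [cite: WarnerGTM94, 6.31 (2)] -/
theorem pairing_compAdj_apply_left {u : (d → ℤ) → V} (hu : Tempered u) {v : (d → ℤ) → V} (hv : RapidDecay v) :
    pairing ((compAdj P Q).apply u) v = pairing u ((P.comp Q).apply v) := by
  rw [compAdj, POp1.apply_comp _ _ hu, POp1.apply_comp P Q hv.tempered,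
    Q.adj.pairing_apply_left (P.adj.tempered_apply hu) hv, POp1.adj_adj,
    P.adj.pairing_apply_left hu (Q.rapidDecay_apply hv), POp1.adj_adj]

/-- `Q†P†` preserves rapid decrease. [folklore] -/
theorem rapidDecay_compAdj_apply {v : (d → ℤ) → V} (hv : RapidDecay v) : RapidDecay ((compAdj P Q).apply v) := by
  rw [compAdj, POp1.apply_comp _ _ hv.tempered]
  exact Q.adj.rapidDecay_apply (P.adj.rapidDecay_apply hv)

/-- `PQ` preserves rapid decrease. [folklore] -/
theorem rapidDecay_comp_apply {v : (d → ℤ) → V} (hv : RapidDecay v) : RapidDecay ((P.comp Q).apply v) := by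
  rw [POp1.apply_comp _ _ hv.tempered]
  exact P.rapidDecay_apply (Q.rapidDecay_apply hv)

/-- **`σ_{(PQ)†}(k) = σ_{PQ}(k)†`.** [cite: WarnerGTM94, 6.24 (3)] -/
theorem compAdj_symbol (k : d → ℤ) :
    (compAdj P Q).symbol k = ContinuousLinearMap.adjoint ((P.comp Q).symbol k) := by
  rw [compAdj, POp1.symbol_comp, POp1.symbol_comp, POp1.adj_symbol, POp1.adj_symbol,
    ContinuousLinearMap.adjoint_comp, neg_comp_neg]
where
  /-- `(-A) ∘ (-B) = A ∘ B` for continuous linear maps. -/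
  neg_comp_neg {A : W →L[ℂ] V} {B : V →L[ℂ] W} : (-A).comp (-B) = A.comp B := by ext; simp

end Comp

/-! ### Laplace-like operators -/

section LaplaceLike

variable (P₁ : POp1 d W V) (Q₁ : POp1 d V W) (P₂ : POp1 d X V) (Q₂ : POp1 d V X)

/-- **The adjoint of `P₁Q₁ + P₂Q₂` is `Q₁†P₁† + Q₂†P₂†`.** [cite: WarnerGTM94, 6.24 (3)] -/
def laplaceLikeAdj : POp d V V := (compAdj P₁ Q₁).add (compAdj P₂ Q₂)

/-- `⟨(P₁Q₁ + P₂Q₂) u, v⟩ = ⟨u, (Q₁†P₁† + Q₂†P₂†) v⟩`. [cite: WarnerGTM94, 6.31 (2)] -/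
theorem pairing_laplaceLike_apply_left {u : (d → ℤ) → V} (hu : Tempered u) {v : (d → ℤ) → V}
    (hv : RapidDecay v) :
    pairing (((P₁.comp Q₁).add (P₂.comp Q₂)).apply u) v = pairing u ((laplaceLikeAdj P₁ Q₁ P₂ Q₂).apply v) := by
  rw [POp.apply_add_op _ _ hu, laplaceLikeAdj, POp.apply_add_op _ _ hv.tempered,
    pairing_add_left' (POp.tempered_apply _ hu) (POp.tempered_apply _ hu) hv,
    pairing_comp_apply_left P₁ Q₁ hu hv, pairing_comp_apply_left P₂ Q₂ hu hv,
    pairing_add_right' hu (rapidDecay_compAdj_apply P₁ Q₁ hv) (rapidDecay_compAdj_apply P₂ Q₂ hv)]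

/-- `⟨(Q₁†P₁† + Q₂†P₂†) u, v⟩ = ⟨u, (P₁Q₁ + P₂Q₂) v⟩`. [cite: WarnerGTM94, 6.31 (2)] -/
theorem pairing_laplaceLikeAdj_apply_left {u : (d → ℤ) → V} (hu : Tempered u) {v : (d → ℤ) → V}
    (hv : RapidDecay v) :
    pairing ((laplaceLikeAdj P₁ Q₁ P₂ Q₂).apply u) v = pairing u (((P₁.comp Q₁).add (P₂.comp Q₂)).apply v) := by
  rw [laplaceLikeAdj, POp.apply_add_op _ _ hu, POp.apply_add_op _ _ hv.tempered,
    pairing_add_left' (POp.tempered_apply _ hu) (POp.tempered_apply _ hu) hv,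
    pairing_compAdj_apply_left P₁ Q₁ hu hv, pairing_compAdj_apply_left P₂ Q₂ hu hv,
    pairing_add_right' hu (rapidDecay_comp_apply P₁ Q₁ hv) (rapidDecay_comp_apply P₂ Q₂ hv)]

/-- **`σ_{L†}(k) = σ_L(k)†` for Laplace-like `L`.** [cite: WarnerGTM94, 6.24 (3)] -/
theorem laplaceLikeAdj_symbol (k : d → ℤ) :
    (laplaceLikeAdj P₁ Q₁ P₂ Q₂).symbol k = ContinuousLinearMap.adjoint (((P₁.comp Q₁).add (P₂.comp Q₂)).symbol k) := by
  rw [laplaceLikeAdj, POp.symbol_add, POp.symbol_add, compAdj_symbol, compAdj_symbol, map_add]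

end LaplaceLike

end Lattice

end Literature.Analysis.FunctionSpaces
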